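import Summits.CriticalPhenomena.PercolationContinuityZ3.Theorems.Transplant.FKDoubleFanWedgeWord
import HarnessLib

/-!
# Double fans `K₂ ∨ P_{m+1}`: LETTER CONES — the invariant-cone principle for cones stable under the WHOLE letters,
# and self-adjointness of the six operators for the bivector pairing

Helper file (`--supports stmt-CriticalPhenomena-4575`), FK sub-lane `prim-bschramm-fk-3` (gen 36); builds on p205010 (kernel theorem, internal
audit signed; external expert review pending).  No named facts, no sorries; standard axioms.  Memo `bschramm/prim-bschramm-fk-3/FAR-CROSS-XI.md` §4.

The termwise principle of `…DoubleFanWedge/…WedgeWord` (`IsOpCone`) asks for a cone of bivectors stable under the SIX polarised operators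
`T_D, W_D, T_a, W_a, T_b, W_b`; on the true input cone that fails below `q_T ≈ 0.423` (memo FAR-CROSS-III).  Here the principle is restated for
cones stable under the whole letters only (**`IsLetterCone`**, with `∧²E_r = r²I + r(1−r)T_D + (1−r)²W_D`, `∧²AC_x`, `∧²BC_y` as single operators
**`opE`, `opAC`, `opBC`**): every `IsOpCone` is an `IsLetterCone` (**`IsOpCone.isLetterCone`**), the word walk and the far cross-apex reduction go
through verbatim (**`IsLetterCone.wedgeH_midWord_mem`**, **`rayleigh_word_of_isLetterCone`**, **`rayleigh_crossFar_of_isLetterCone`**).  Second, the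
pairing `pairH` is symmetric and the six operators — hence the three letter operators — are SELF-ADJOINT for it (**`pairH_opTD`**, …, **`pairH_opE`**,
**`pairH_opAC`**, **`pairH_opBC`**): absorbing a letter into the input side or into the target side is the same thing.  Used by
`…DoubleFanOneSidedDominance` to build the dual one-sided cone.
[cite: Grimmett2006, §3.9 eq. (3.94) (pp. 63–64)] [folklore]
-/

noncomputable section

namespace Summit.CriticalPhenomena.PercolationContinuityZ3.Theorems

namespace FK

namespace ThreeApex

/-! ### Whole-letter operators on bivectors and letter cones -/

/-- `∧²E_r` on bivectors: `r²·I + r(1−r)·T_D + (1−r)²·W_D`. [folklore] -/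
def opE (q r : ℝ) (β : Biv) : Biv := Biv.lin3 (r ^ 2) β (r * (1 - r)) (opTD q β) ((1 - r) ^ 2) (opWD q β)

/-- `∧²AC_x` on bivectors: `(1−x)²·I + x(1−x)·T_a + x²·W_a`. [folklore] -/
def opAC (x : ℝ) (β : Biv) : Biv := Biv.lin3 ((1 - x) ^ 2) β (x * (1 - x)) (opTa β) (x ^ 2) (opWa β)

/-- `∧²BC_y` on bivectors: `(1−y)²·I + y(1−y)·T_b + y²·W_b`. [folklore] -/
def opBC (y : ℝ) (β : Biv) : Biv := Biv.lin3 ((1 - y) ^ 2) β (y * (1 - y)) (opTb β) (y ^ 2) (opWb β)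

/-- `∧²E_r (X ∧ Y) = E_r X ∧ E_r Y`. [folklore] -/
theorem opE_wedgeH (q r : ℝ) (X Y : V5) : opE q r (wedgeH X Y) = wedgeH (rimStep q r X) (rimStep q r Y) := by
  rw [opE, wedgeH_rimStep]

/-- `∧²AC_x (X ∧ Y) = AC_x X ∧ AC_x Y`. [folklore] -/
theorem opAC_wedgeH (x : ℝ) (X Y : V5) : opAC x (wedgeH X Y) = wedgeH (conv (edgeAC x) X) (conv (edgeAC x) Y) := by
  rw [opAC, wedgeH_conv_edgeAC]

/-- `∧²BC_y (X ∧ Y) = BC_y X ∧ BC_y Y`. [folklore] -/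
theorem opBC_wedgeH (y : ℝ) (X Y : V5) : opBC y (wedgeH X Y) = wedgeH (conv (edgeBC y) X) (conv (edgeBC y) Y) := by
  rw [opBC, wedgeH_conv_edgeBC]

/-- A convex cone of bivectors mapped into itself by the WHOLE letters `∧²E_r`, `∧²AC_x`, `∧²BC_y` (`r, x, y ∈ [0,1]`) — weaker than
`IsOpCone`, which asks for stability under the six polarised pieces separately. [folklore] -/
@[folklore] structure IsLetterCone (q : ℝ) (K : Set Biv) : Prop where
  /-- `0 ∈ K` -/
  zero_mem : (⟨0, 0, 0, 0, 0, 0, 0, 0, 0, 0⟩ : Biv) ∈ K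
  /-- closed under sums -/
  add_mem : ∀ β γ, β ∈ K → γ ∈ K → Biv.add β γ ∈ K
  /-- closed under non-negative multiples -/
  smul_mem : ∀ (a : ℝ) β, 0 ≤ a → β ∈ K → Biv.smul a β ∈ K
  /-- `∧²E_r K ⊆ K` -/
  rim : ∀ (r : ℝ) β, 0 ≤ r → r ≤ 1 → β ∈ K → opE q r β ∈ K
  /-- `∧²AC_x K ⊆ K` -/
  ac : ∀ (x : ℝ) β, 0 ≤ x → x ≤ 1 → β ∈ K → opAC x β ∈ K
  /-- `∧²BC_y K ⊆ K` -/
  bc : ∀ (y : ℝ) β, 0 ≤ y → y ≤ 1 → β ∈ K → opBC y β ∈ K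

/-- Every operator cone is a letter cone. [folklore] -/
theorem IsOpCone.isLetterCone {q : ℝ} {K : Set Biv} (hK : IsOpCone q K) : IsLetterCone q K where
  zero_mem := hK.zero_mem
  add_mem := hK.add_mem
  smul_mem := hK.smul_mem
  rim := fun r β hr0 hr1 hβ => by
    unfold opE; exact hK.lin3_mem (by positivity) (mul_nonneg hr0 (by linarith)) (by positivity) hβ (hK.td _ hβ) (hK.wd _ hβ)
  ac := fun x β hx0 hx1 hβ => by
    unfold opAC; exact hK.lin3_mem (by positivity) (mul_nonneg hx0 (by linarith)) (by positivity) hβ (hK.ta _ hβ) (hK.wa _ hβ)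
  bc := fun y β hy0 hy1 hβ => by
    unfold opBC; exact hK.lin3_mem (by positivity) (mul_nonneg hy0 (by linarith)) (by positivity) hβ (hK.tb _ hβ) (hK.wb _ hβ)

namespace IsLetterCone

variable {q : ℝ} {K : Set Biv}

/-- Rim steps keep the pair bivector in a letter cone. [folklore] -/
theorem wedgeH_rimStep_mem (hK : IsLetterCone q K) {r : ℝ} (hr0 : 0 ≤ r) (hr1 : r ≤ 1) {X Y : V5} (h : wedgeH X Y ∈ K) :
    wedgeH (rimStep q r X) (rimStep q r Y) ∈ K := by
  rw [← opE_wedgeH]; exact hK.rim r _ hr0 hr1 h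

/-- `a`-spokes keep the pair bivector in a letter cone. [folklore] -/
theorem wedgeH_conv_edgeAC_mem (hK : IsLetterCone q K) {x : ℝ} (hx0 : 0 ≤ x) (hx1 : x ≤ 1) {X Y : V5} (h : wedgeH X Y ∈ K) :
    wedgeH (conv (edgeAC x) X) (conv (edgeAC x) Y) ∈ K := by
  rw [← opAC_wedgeH]; exact hK.ac x _ hx0 hx1 h

/-- `b`-spokes keep the pair bivector in a letter cone. [folklore] -/
theorem wedgeH_conv_edgeBC_mem (hK : IsLetterCone q K) {y : ℝ} (hy0 : 0 ≤ y) (hy1 : y ≤ 1) {X Y : V5} (h : wedgeH X Y ∈ K) :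
    wedgeH (conv (edgeBC y) X) (conv (edgeBC y) Y) ∈ K := by
  rw [← opBC_wedgeH]; exact hK.bc y _ hy0 hy1 h

/-- **The middle word keeps the pair bivector in a letter cone** (blocks with weights in `[0,1]`). [folklore] -/
theorem wedgeH_midWord_mem (hK : IsLetterCone q K) :
    ∀ {mids : List (ℝ × ℝ × ℝ)}, UnitBlocks mids → ∀ {X Y : V5}, wedgeH X Y ∈ K → wedgeH (midWord q mids X) (midWord q mids Y) ∈ K := by
  intro mids
  induction mids with
  | nil => intro _ X Y h; simpa [midWord] using h
  | cons blk rest ih =>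
    intro hm X Y h
    have hb := hm blk (by simp)
    have hrest : UnitBlocks rest := fun b hb' => hm b (by simp [hb'])
    simp only [midWord]
    exact ih hrest (hK.wedgeH_conv_edgeAC_mem hb.2.2.1 hb.2.2.2.1
      (hK.wedgeH_conv_edgeBC_mem hb.2.2.2.2.1 hb.2.2.2.2.2 (hK.wedgeH_rimStep_mem hb.1 hb.2.1 h)))

end IsLetterCone

/-- **The letter-cone principle for a double-fan word** (as `rayleigh_word_of_isOpCone`, with the weaker hypothesis). [folklore] -/
theorem rayleigh_word_of_isLetterCone {q : ℝ} {K : Set Biv} (hK : IsLetterCone q K) {mids : List (ℝ × ℝ × ℝ)} (hm : UnitBlocks mids)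
    {rd : ℝ} (hrd0 : 0 ≤ rd) (hrd1 : rd ≤ 1) {X₀ X₁ Y₀ Y₁ : V5} (hu : wedgeH X₀ X₁ ∈ K)
    (hs : ∀ β, β ∈ K → 0 ≤ pairH q β (wedgeH Y₀ Y₁)) :
    val q (conv Y₁ (rimStep q rd (midWord q mids X₁))) * val q (conv Y₀ (rimStep q rd (midWord q mids X₀))) ≤
      val q (conv Y₀ (rimStep q rd (midWord q mids X₁))) * val q (conv Y₁ (rimStep q rd (midWord q mids X₀))) := by
  have hmem : wedgeH (rimStep q rd (midWord q mids X₀)) (rimStep q rd (midWord q mids X₁)) ∈ K :=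
    hK.wedgeH_rimStep_mem hrd0 hrd1 (hK.wedgeH_midWord_mem hm hu)
  have key := rayleigh_of_isOpCone hmem hs
  have e : ∀ X Y : V5, conv Y X = conv X Y := fun X Y => by simp only [← mul_def]; ac_rfl
  rw [e _ Y₁, e _ Y₀, e _ Y₀, e _ Y₁]
  linarith [key]

/-- **The far cross-apex pair through a letter cone**: `K ∋ u ∧ P_a u` and `K` pairs non-negatively with `(s ∗ BC_0) ∧ (s ∗ BC_1)` give
`Z¹¹Z⁰⁰ ≤ Z¹⁰Z⁰¹` for every block list and every last rim weight in `[0,1]`. [folklore] -/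
theorem rayleigh_crossFar_of_isLetterCone {q : ℝ} {K : Set Biv} (hK : IsLetterCone q K) {mids : List (ℝ × ℝ × ℝ)} (hm : UnitBlocks mids)
    {rd : ℝ} (hrd0 : 0 ≤ rd) (hrd1 : rd ≤ 1) {u s : V5}
    (hu : wedgeH (conv (edgeAC 0) u) (conv (edgeAC 1) u) ∈ K)
    (hs : ∀ β, β ∈ K → 0 ≤ pairH q β (wedgeH (conv s (edgeBC 0)) (conv s (edgeBC 1)))) :
    val q (conv s (conv (edgeBC 1) (rimStep q rd (midWord q mids (conv (edgeAC 1) u))))) *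
        val q (conv s (conv (edgeBC 0) (rimStep q rd (midWord q mids (conv (edgeAC 0) u))))) ≤
      val q (conv s (conv (edgeBC 0) (rimStep q rd (midWord q mids (conv (edgeAC 1) u))))) *
        val q (conv s (conv (edgeBC 1) (rimStep q rd (midWord q mids (conv (edgeAC 0) u))))) := by
  have key := rayleigh_word_of_isLetterCone hK hm hrd0 hrd1 hu hs
  have e : ∀ (τ : ℝ) (X : V5), conv s (conv (edgeBC τ) X) = conv (conv s (edgeBC τ)) X := by
    intro τ X; simp only [← mul_def]; ac_rfl
  simp only [e]
  exact key

/-! ### The pairing: symmetry, linearity, self-adjointness of the letters -/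

/-- `pairH` is symmetric. [folklore] -/
theorem pairH_comm (q : ℝ) (β γ : Biv) : pairH q β γ = pairH q γ β := by
  simp only [pairH]; ring

/-- `pairH` of the zero bivector. [folklore] -/
theorem pairH_zero_left (q : ℝ) (γ : Biv) : pairH q (⟨0, 0, 0, 0, 0, 0, 0, 0, 0, 0⟩ : Biv) γ = 0 := by
  simp only [pairH]; ring

/-- `pairH` is additive in the first argument. [folklore] -/
theorem pairH_add_left (q : ℝ) (β γ δ : Biv) : pairH q (Biv.add β γ) δ = pairH q β δ + pairH q γ δ := by
  simp only [pairH, Biv.add]; ring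

/-- `pairH` is homogeneous in the first argument. [folklore] -/
theorem pairH_smul_left (q a : ℝ) (β γ : Biv) : pairH q (Biv.smul a β) γ = a * pairH q β γ := by
  simp only [pairH, Biv.smul]; ring

/-- `T_D` is self-adjoint for `pairH`. [folklore] -/
theorem pairH_opTD (q : ℝ) (β γ : Biv) : pairH q (opTD q β) γ = pairH q β (opTD q γ) := by
  simp only [pairH, opTD]; ring

/-- `W_D` is self-adjoint for `pairH`. [folklore] -/
theorem pairH_opWD (q : ℝ) (β γ : Biv) : pairH q (opWD q β) γ = pairH q β (opWD q γ) := by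
  simp only [pairH, opWD, formD]; ring

/-- `T_a` is self-adjoint for `pairH`. [folklore] -/
theorem pairH_opTa (q : ℝ) (β γ : Biv) : pairH q (opTa β) γ = pairH q β (opTa γ) := by
  simp only [pairH, opTa]; ring

/-- `W_a` is self-adjoint for `pairH`. [folklore] -/
theorem pairH_opWa (q : ℝ) (β γ : Biv) : pairH q (opWa β) γ = pairH q β (opWa γ) := by
  simp only [pairH, opWa]; ring

/-- `T_b` is self-adjoint for `pairH`. [folklore] -/
theorem pairH_opTb (q : ℝ) (β γ : Biv) : pairH q (opTb β) γ = pairH q β (opTb γ) := by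
  simp only [pairH, opTb]; ring

/-- `W_b` is self-adjoint for `pairH`. [folklore] -/
theorem pairH_opWb (q : ℝ) (β γ : Biv) : pairH q (opWb β) γ = pairH q β (opWb γ) := by
  simp only [pairH, opWb]; ring

/-- `∧²E_r` is self-adjoint for `pairH`. [folklore] -/
theorem pairH_opE (q r : ℝ) (β γ : Biv) : pairH q (opE q r β) γ = pairH q β (opE q r γ) := by
  simp only [opE, Biv.lin3, Biv.add, Biv.smul, pairH, opTD, opWD, formD]; ring

/-- `∧²AC_x` is self-adjoint for `pairH`. [folklore] -/
theorem pairH_opAC (q x : ℝ) (β γ : Biv) : pairH q (opAC x β) γ = pairH q β (opAC x γ) := by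
  simp only [opAC, Biv.lin3, Biv.add, Biv.smul, pairH, opTa, opWa]; ring

/-- `∧²BC_y` is self-adjoint for `pairH`. [folklore] -/
theorem pairH_opBC (q y : ℝ) (β γ : Biv) : pairH q (opBC y β) γ = pairH q β (opBC y γ) := by
  simp only [opBC, Biv.lin3, Biv.add, Biv.smul, pairH, opTb, opWb]; ring

end ThreeApex

end FK

end Summit.CriticalPhenomena.PercolationContinuityZ3.Theorems
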